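import Mathlib.FieldTheory.Galois.Infinite
import Literature.NumberTheory.GaloisCohomology.PoitouTateRestrictedRamification
import Literature.NumberTheory.GaloisRepresentations.GaloisCohomologyInfResProofs
import Literature.NumberTheory.GaloisRepresentations.ArtinRestriction
import Literature.NumberTheory.GaloisRepresentations.IntegralGaloisAction
import HarnessLib

/-!
# `H¹(G_S, M)` is the group of classes of `H¹(K, M)` unramified outside `S` (proved)

Let `K` be a field, `S` a set of finite places, `N_S = ramificationSubgroup K S ⊴ Γ_K` the closed
normal subgroup generated by the inertia groups `I_𝔓`, `𝔓 ∣ v ∉ S`, and `G_S = Γ_K ⧸ N_S =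
Gal(K_S/K)` (`RestrictedRamification.lean`).  For a discrete `Γ_K`-module `M` the file
`PoitouTateRestrictedRamification.lean` introduced `Hⁿ(G_S, M^{N_S})` (`restrictedCohomology`) and the
inflation `restrictedInf : Hⁿ(G_S, M^{N_S}) → Hⁿ(K, M)`.  This file PROVES the degree-one comparison
underlying every use of `G_S`-cohomology for Selmer groups (Neukirch–Schmidt–Wingberg (1.6.7), the
five-term sequence `0 → H¹(G/H, A^H) → H¹(G, A) → H¹(H, A)^{G/H} → …` for the closed normal subgroup
`H = N_S = Gal(K̄/K_S)` of `G = Γ_K`; Milne, *Arithmetic Duality Theorems*, I §4 (classes of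
`H¹(G_S, M)` as classes over `K` unramified outside `S`); Rubin, *Euler Systems*, App. B.2):

* `DiscreteGaloisModule.restrictedInf_one_injective` — `inf : H¹(G_S, M^{N_S}) → H¹(K, M)` is
  injective (the tree's `galoisCohomology.inf_one_injective_holds` for the closed normal `N_S`);
* `DiscreteGaloisModule.exact_restrictedInf_resRamification` — `H¹(G_S, M^{N_S}) →(inf) H¹(K, M)
  →(res) H¹(N_S, M)` is exact (`resRamification` = restriction along `N_S ↪ Γ_K`; the tree's
  general `ContinuousCohomology.exact_inf_res_one`);
* `DiscreteGaloisModule.mem_range_restrictedInf_iff_forall_isUnramifiedAt` — for a `G_S`-module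
  `M` (`M` unramified outside `S`), a class `c ∈ H¹(K, M)` is inflated from `H¹(G_S, M)` **iff it is
  unramified at every finite place outside `S`** in the tree's sense `galoisCohomology.IsUnramifiedAt`
  (restriction to the inertia FIELDS `K̄^{I_𝔓}`, `𝔓 ∣ v`, vanishes).  Ingredients: the image of
  `Γ_{K̄^{I_𝔓}} → Γ_K` is a conjugate `g I_𝔓 g⁻¹` (`exists_range_absGaloisRestrict_absInertiaField`:
  embeddings extend to `Γ_K`, `exists_mem_range_absGaloisRestrict_iff`, and Krull's Galois
  correspondence `InfiniteGalois.fixingSubgroup_fixedField` for the CLOSED subgroup `I_𝔓`,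
  `absIntegers.isClosed_inertia_holds`); a continuous crossed homomorphism `f : Γ_K → M` which is a
  coboundary on `g I_𝔓 g⁻¹ ≤ N_S` vanishes there (`N_S` acts trivially), its zero set inside `N_S`
  is a closed subgroup normalised by `Γ_K`, hence contains `N_S`; and exactness.

No named facts; sorry-free; the number-field hypothesis enters only through `CharZero K` (the tree's
compactness of `Γ_K` and `IsGalois K K̄`) and the type of places.

## References

* J. Neukirch, A. Schmidt, K. Wingberg, *Cohomology of Number Fields*, 2nd ed. (2008), (1.6.7),
  VIII §3. [NeukirchSchmidtWingberg2008]
* J. S. Milne, *Arithmetic Duality Theorems*, 2nd ed. (2006), I §4 (p. 55: "`H¹_un(K_v, M)`",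
  Lemma 4.8 and its proof). [MilneADT2006]
* D. Harari, *Galois Cohomology and Class Field Theory* (2020), Def. 15.36, Remark 17.7 (b).
  [Harari2020]
-/

noncomputable section

open Function Field IsDedekindDomain CategoryTheory
open scoped NumberField

universe u

namespace Literature.NumberTheory.GaloisRepresentations

namespace DiscreteGaloisModule

variable {K : Type u} [Field K] {M : Type u} [AddCommGroup M] [TopologicalSpace M]
  [DiscreteTopology M]

/-! ## §1. Restriction to `N_S` and inflation–restriction -/

variable (K) in
/-- The inclusion `N_S ↪ Γ_K` of the ramification subgroup outside `S`, as a continuous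
homomorphism. [cite: NeukirchSchmidtWingberg2008, VIII §3] -/
def ramificationSubgroupIncl (S : Set (HeightOneSpectrum (𝓞 K))) :
    ramificationSubgroup K S →ₜ* absoluteGaloisGroup K :=
  ⟨(ramificationSubgroup K S).subtype, continuous_subtype_val⟩

/-- Unfolding lemma for `ramificationSubgroupIncl`. [cite: NeukirchSchmidtWingberg2008, VIII §3] -/
@[simp] theorem ramificationSubgroupIncl_apply (S : Set (HeightOneSpectrum (𝓞 K)))
    (σ : ramificationSubgroup K S) : ramificationSubgroupIncl K S σ = (σ : absoluteGaloisGroup K) :=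
  rfl

/-- **`Hⁿ(N_S, M)`**: the continuous cohomology of the ramification subgroup `N_S = Gal(K̄/K_S)`
with coefficients in the restriction of the discrete `Γ_K`-module `M` (the third term of the
inflation–restriction sequence for `G_S = Γ_K ⧸ N_S`). [cite: NeukirchSchmidtWingberg2008, (1.6.7)] -/
abbrev ramificationCohomology (ρ : DiscreteGaloisModule K M) (S : Set (HeightOneSpectrum (𝓞 K)))
    (n : ℕ) : Type u :=
  (continuousCohomology n
    (ContinuousRep.restrict ρ (ramificationSubgroupIncl K S)).toTopRep : TopModuleCat ℤ)

/-- The **restriction** `Hⁿ(K, M) →+ Hⁿ(N_S, M)` to the ramification subgroup (Mathlib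
`ContinuousCohomology.map` along `N_S ↪ Γ_K`). [cite: NeukirchSchmidtWingberg2008, (1.6.7)] -/
def resRamification (ρ : DiscreteGaloisModule K M) (S : Set (HeightOneSpectrum (𝓞 K))) (n : ℕ) :
    galoisCohomology ρ n →+ ρ.ramificationCohomology S n :=
  (ContinuousCohomology.map (ramificationSubgroupIncl K S) (X := ρ.toTopRep)
    (Y := (ContinuousRep.restrict ρ (ramificationSubgroupIncl K S)).toTopRep)
    (TopRep.ofHom ⟨ContinuousLinearMap.id ℤ M, fun _ => rfl⟩) n).hom.toLinearMap.toAddMonoidHom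

/-- **Injectivity of inflation** `inf : H¹(G_S, M^{N_S}) → H¹(K, M)` (the tree's
`galoisCohomology.inf_one_injective_holds` for the closed normal subgroup `N_S`).
[cite: NeukirchSchmidtWingberg2008, (1.6.7)] -/
theorem restrictedInf_one_injective (ρ : DiscreteGaloisModule K M)
    (S : Set (HeightOneSpectrum (𝓞 K))) : Function.Injective (ρ.restrictedInf S 1) :=
  galoisCohomology.inf_one_injective_holds K M ρ (ramificationSubgroup K S)
    (ramificationSubgroup_isClosed K S)

/-- **Inflation–restriction for `G_S`**: `H¹(G_S, M^{N_S}) →(inf) H¹(K, M) →(res) H¹(N_S, M)` is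
exact at `H¹(K, M)` (the tree's `ContinuousCohomology.exact_inf_res_one` with `G = Γ_K`, the normal
subgroup `N_S`, `XQ = M^{N_S}`, `H = N_S` and `φ` the inclusion).
[cite: NeukirchSchmidtWingberg2008, (1.6.7)] -/
theorem exact_restrictedInf_resRamification (ρ : DiscreteGaloisModule K M)
    (S : Set (HeightOneSpectrum (𝓞 K))) :
    Function.Exact (ρ.restrictedInf S 1) (ρ.resRamification S 1) :=
  ContinuousCohomology.exact_inf_res_one (ramificationSubgroup K S) (X := ρ.toTopRep)
    (XQ := (ρ.quotientInvariants (ramificationSubgroup K S)).toTopRep)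
    (Y := (ContinuousRep.restrict ρ (ramificationSubgroupIncl K S)).toTopRep)
    (TopRep.ofHom ⟨Submodule.subtypeL _, fun _ => rfl⟩) (ramificationSubgroupIncl K S)
    (TopRep.ofHom ⟨ContinuousLinearMap.id ℤ M, fun _ => rfl⟩)
    Subtype.val_injective Topology.IsInducing.subtypeVal (fun m hm => ⟨⟨m, fun s => hm s.1 s.2⟩, rfl⟩)
    (fun h => h.2) (fun s hs => ⟨⟨s, hs⟩, rfl⟩) Function.bijective_id
    (fun m => ρ.continuous_apply_left m)

/-- `res_{N_S} [f] = [f|_{N_S}]` on classes of continuous crossed homomorphisms.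
[cite: NeukirchSchmidtWingberg2008, (1.6.7)] -/
theorem resRamification_oneCocycleClass (ρ : DiscreteGaloisModule K M)
    (S : Set (HeightOneSpectrum (𝓞 K))) (f : contOneCocycles ρ.toTopRep) :
    ρ.resRamification S 1 (oneCocycleClass ρ.toTopRep f) =
      oneCocycleClass (ContinuousRep.restrict ρ (ramificationSubgroupIncl K S)).toTopRep
        (contOneCocycles.pullback (ramificationSubgroupIncl K S) (X := ρ.toTopRep)
          (Y := (ContinuousRep.restrict ρ (ramificationSubgroupIncl K S)).toTopRep)
          (TopRep.ofHom ⟨ContinuousLinearMap.id ℤ M, fun _ => rfl⟩) f) :=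
  map_oneCocycleClass _ _ _ f

/-- A class `[f] ∈ H¹(K, M)` whose cocycle VANISHES on `N_S` restricts to zero in `H¹(N_S, M)`,
hence (exactness) is inflated from `H¹(G_S, M^{N_S})`. [cite: NeukirchSchmidtWingberg2008, (1.6.7)] -/
theorem oneCocycleClass_mem_range_restrictedInf_of_forall_eq_zero (ρ : DiscreteGaloisModule K M)
    (S : Set (HeightOneSpectrum (𝓞 K))) (f : contOneCocycles ρ.toTopRep)
    (hf : ∀ σ ∈ ramificationSubgroup K S, f.1 σ = 0) :
    oneCocycleClass ρ.toTopRep f ∈ Set.range (ρ.restrictedInf S 1) := by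
  refine ((ρ.exact_restrictedInf_resRamification S) (oneCocycleClass ρ.toTopRep f)).1 ?_
  have h0 : contOneCocycles.pullback (ramificationSubgroupIncl K S) (X := ρ.toTopRep)
      (Y := (ContinuousRep.restrict ρ (ramificationSubgroupIncl K S)).toTopRep)
      (TopRep.ofHom ⟨ContinuousLinearMap.id ℤ M, fun _ => rfl⟩) f = 0 :=
    Subtype.ext (ContinuousMap.ext fun σ => hf σ.1 σ.2)
  have h1 := ρ.resRamification_oneCocycleClass S f
  rw [h0] at h1
  exact h1.trans (oneCocycleClass_zero _)

/-! ## §2. The image of `Γ_{K̄^{I_𝔓}} → Γ_K` is a conjugate of the inertia group `I_𝔓` -/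

section InertiaField

variable [CharZero K]

/-- **The absolute Galois group of the inertia field restricts onto a conjugate of `I_𝔓`.**  For a
prime `𝔓` of `\bar ℤ_K` with inertia group `I_𝔓 ≤ Γ_K` and inertia field `T = K̄^{I_𝔓}`
(`absInertiaField`), the image of the restriction `Γ_T → Γ_K` (`absGaloisRestrict`, along the tree's
chosen `K̄ ≅ T̄`) is `g I_𝔓 g⁻¹` for some `g ∈ Γ_K`: it is `Gal(K̄/e(T))` for a `K`-embedding
`e : T → K̄` (`exists_mem_range_absGaloisRestrict_iff`), `e = g|_T` for some `g`
(`exists_absoluteGaloisGroup_smul_eq`), and `Gal(K̄/T) = I_𝔓` by Krull's Galois correspondence for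
the CLOSED subgroup `I_𝔓` (`InfiniteGalois.fixingSubgroup_fixedField`, `absIntegers.isClosed_inertia_holds`).
[cite: NeukirchSchmidtWingberg2008, VIII §3] -/
theorem exists_range_absGaloisRestrict_absInertiaField (𝔓 : Ideal (absIntegers (𝓞 K) K)) :
    ∃ g : absoluteGaloisGroup K, ∀ γ : absoluteGaloisGroup K,
      γ ∈ (absGaloisRestrict K (absInertiaField K 𝔓)).range ↔
        g⁻¹ * γ * g ∈ 𝔓.inertia (absoluteGaloisGroup K) := by
  haveI : IsGalois K (AlgebraicClosure K) := {}
  set L : IntermediateField K (AlgebraicClosure K) := absInertiaField K 𝔓 with hL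
  obtain ⟨e, he⟩ := exists_mem_range_absGaloisRestrict_iff K L
  obtain ⟨g, hg⟩ := exists_absoluteGaloisGroup_smul_eq L e
  refine ⟨g, fun γ => ?_⟩
  have hfix : (L.fixingSubgroup : Subgroup (absoluteGaloisGroup K)) =
      𝔓.inertia (absoluteGaloisGroup K) :=
    InfiniteGalois.fixingSubgroup_fixedField
      ⟨𝔓.inertia (absoluteGaloisGroup K), absIntegers.isClosed_inertia_holds (R := 𝓞 K) (K := K) 𝔓⟩
  rw [he γ, forall_smul_eq_iff_mem_conj L e hg γ, ← mem_fixingSubgroup_iff_forall_smul, hfix]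
  exact Iff.rfl

/-- Consequently the image of `Γ_{K̄^{I_𝔓}} → Γ_K` lies in `N_S` for every prime `𝔓` above a finite
place `v ∉ S` (`N_S` is normal and contains `I_𝔓`). [cite: NeukirchSchmidtWingberg2008, VIII §3] -/
theorem absGaloisRestrict_absInertiaField_mem_ramificationSubgroup
    {S : Set (HeightOneSpectrum (𝓞 K))} {v : HeightOneSpectrum (𝓞 K)} (hv : v ∉ S)
    {𝔓 : Ideal (absIntegers (𝓞 K) K)} (h𝔓 : 𝔓 ∈ v.primesAbove)
    (h : absoluteGaloisGroup (absInertiaField K 𝔓)) :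
    absGaloisRestrict K (absInertiaField K 𝔓) h ∈ ramificationSubgroup K S := by
  obtain ⟨g, hg⟩ := exists_range_absGaloisRestrict_absInertiaField (K := K) 𝔓
  have hmem : g⁻¹ * absGaloisRestrict K (absInertiaField K 𝔓) h * g ∈ ramificationSubgroup K S :=
    inertia_le_ramificationSubgroup hv h𝔓 ((hg _).1 ⟨h, rfl⟩)
  have := (ramificationSubgroup_normal K S).conj_mem _ hmem g
  simpa [mul_assoc] using this

end InertiaField

/-! ## §3. Inflated classes are exactly the classes unramified outside `S` -/

section Unramified

/-- The zero set, inside `N_S`, of a continuous crossed homomorphism `f : Γ_K → M` on a `G_S`-module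
`M` is a subgroup (on `N_S` the cocycle `f` is a homomorphism). [cite: NeukirchSchmidtWingberg2008, (1.6.7)] -/
private def zeroSetIn (ρ : DiscreteGaloisModule K M) (S : Set (HeightOneSpectrum (𝓞 K)))
    (hρ : ramificationSubgroup K S ≤ ContinuousRep.ker ρ) (f : contOneCocycles ρ.toTopRep) :
    Subgroup (absoluteGaloisGroup K) where
  carrier := {σ | σ ∈ ramificationSubgroup K S ∧ f.1 σ = 0}
  one_mem' := ⟨one_mem _, contOneCocycles.apply_one f⟩
  mul_mem' := by
    rintro a b ⟨ha, hfa⟩ ⟨hb, hfb⟩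
    refine ⟨mul_mem ha hb, ?_⟩
    rw [f.2 a b, hfa, hfb, map_zero, add_zero]
  inv_mem' := by
    rintro a ⟨ha, hfa⟩
    refine ⟨inv_mem ha, ?_⟩
    have h1 := f.2 a a⁻¹
    rw [mul_inv_cancel, contOneCocycles.apply_one, hfa, zero_add] at h1
    -- `0 = ρ a (f a⁻¹)` and `ρ a` is injective
    have ha' : ρ a = LinearMap.id := (ContinuousRep.mem_ker ρ a).1 (hρ ha)
    have h2 : (ρ.toTopRep).ρ a (f.1 a⁻¹) = ρ a (f.1 a⁻¹) := rfl
    rw [h2, ha', LinearMap.id_apply] at h1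
    exact h1.symm

/-- Membership in the zero set inside `N_S`. [cite: NeukirchSchmidtWingberg2008, (1.6.7)] -/
private theorem mem_zeroSetIn_iff (ρ : DiscreteGaloisModule K M) (S : Set (HeightOneSpectrum (𝓞 K)))
    (hρ : ramificationSubgroup K S ≤ ContinuousRep.ker ρ) (f : contOneCocycles ρ.toTopRep)
    (σ : absoluteGaloisGroup K) :
    σ ∈ zeroSetIn ρ S hρ f ↔ σ ∈ ramificationSubgroup K S ∧ f.1 σ = 0 :=
  Iff.rfl

/-- The zero set inside `N_S` of a crossed homomorphism is normalised by `Γ_K`: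
`f(τστ⁻¹) = f(τ) + τ f(σ) + τσ f(τ⁻¹) = f(τ) + τ f(τ⁻¹) = f(1) = 0` when `f σ = 0` and `σ` acts
trivially. [cite: NeukirchSchmidtWingberg2008, (1.6.7)] -/
private theorem zeroSetIn_normal (ρ : DiscreteGaloisModule K M) (S : Set (HeightOneSpectrum (𝓞 K)))
    (hρ : ramificationSubgroup K S ≤ ContinuousRep.ker ρ) (f : contOneCocycles ρ.toTopRep) :
    (zeroSetIn ρ S hρ f).Normal := by
  refine ⟨fun σ hσ τ => ?_⟩
  obtain ⟨hσN, hfσ⟩ := (mem_zeroSetIn_iff ρ S hρ f σ).1 hσ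
  refine (mem_zeroSetIn_iff ρ S hρ f _).2 ⟨(ramificationSubgroup_normal K S).conj_mem σ hσN τ, ?_⟩
  have hσ' : ρ σ = LinearMap.id := (ContinuousRep.mem_ker ρ σ).1 (hρ hσN)
  have hρσ : ∀ m : M, (ρ.toTopRep).ρ σ m = m := fun m => by
    change ρ σ m = m
    rw [hσ', LinearMap.id_apply]
  have h1 : f.1 (τ * σ * τ⁻¹) = f.1 τ + (ρ.toTopRep).ρ τ (f.1 (σ * τ⁻¹)) := by
    rw [mul_assoc, f.2 τ (σ * τ⁻¹)]
  have h2 : f.1 (σ * τ⁻¹) = f.1 τ⁻¹ := by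
    rw [f.2 σ τ⁻¹, hfσ, zero_add, hρσ]
  have h3 : f.1 τ + (ρ.toTopRep).ρ τ (f.1 τ⁻¹) = 0 := by
    rw [← f.2 τ τ⁻¹, mul_inv_cancel, contOneCocycles.apply_one]
  rw [h1, h2, h3]

/-- The zero set inside `N_S` is closed (`f` is continuous, `M` is discrete, `N_S` is closed).
[cite: NeukirchSchmidtWingberg2008, (1.6.7)] -/
private theorem isClosed_zeroSetIn (ρ : DiscreteGaloisModule K M)
    (S : Set (HeightOneSpectrum (𝓞 K))) (hρ : ramificationSubgroup K S ≤ ContinuousRep.ker ρ)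
    (f : contOneCocycles ρ.toTopRep) :
    IsClosed ((zeroSetIn ρ S hρ f : Subgroup (absoluteGaloisGroup K)) : Set (absoluteGaloisGroup K)) := by
  have h : ((zeroSetIn ρ S hρ f : Subgroup (absoluteGaloisGroup K)) : Set (absoluteGaloisGroup K)) =
      (ramificationSubgroup K S : Set (absoluteGaloisGroup K)) ∩ f.1 ⁻¹' {0} := rfl
  rw [h]
  exact (ramificationSubgroup_isClosed K S).inter
    ((isClosed_discrete {(0 : M)}).preimage f.1.continuous)

/-- **A crossed homomorphism on a `G_S`-module which is a coboundary on every inertia group outside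
`S` vanishes on `N_S`.**  Precisely: if `M` is unramified outside `S` and, for every `v ∉ S` and every
prime `𝔓 ∣ v`, `f` vanishes on `I_𝔓`, then `f = 0` on `N_S` (the zero set is a closed subgroup
normalised by `Γ_K` containing the inertia groups). [cite: NeukirchSchmidtWingberg2008, (1.6.7) and VIII §3] -/
theorem forall_ramificationSubgroup_eq_zero_of_forall_inertia (ρ : DiscreteGaloisModule K M)
    {S : Set (HeightOneSpectrum (𝓞 K))} (hρ : ramificationSubgroup K S ≤ ContinuousRep.ker ρ)
    (f : contOneCocycles ρ.toTopRep)
    (hf : ∀ v ∉ S, ∀ 𝔓 ∈ v.primesAbove, ∀ σ ∈ 𝔓.inertia (absoluteGaloisGroup K), f.1 σ = 0) :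
    ∀ σ ∈ ramificationSubgroup K S, f.1 σ = 0 := by
  haveI := zeroSetIn_normal ρ S hρ f
  have hle : ramificationSubgroup K S ≤ zeroSetIn ρ S hρ f := by
    refine Subgroup.topologicalClosure_minimal _ ?_ (isClosed_zeroSetIn ρ S hρ f)
    refine Subgroup.normalClosure_le_normal fun σ hσ => ?_
    obtain ⟨v, hv, 𝔓, h𝔓, hσ𝔓⟩ := mem_inertiaOutside_iff.mp hσ
    exact ⟨inertia_le_ramificationSubgroup hv h𝔓 hσ𝔓, hf v hv 𝔓 h𝔓 σ hσ𝔓⟩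
  exact fun σ hσ => ((mem_zeroSetIn_iff ρ S hρ f σ).1 (hle hσ)).2

variable [CharZero K]

/-- **Classes of `H¹(G_S, M)` are exactly the classes of `H¹(K, M)` unramified outside `S`.**  Let
`M` be a `G_S`-module, i.e. a discrete `Γ_K`-module unramified outside `S`
(`GaloisRep.IsUnramifiedOutside S ρ`).  Then `c ∈ H¹(K, M)` lies in the image of the inflation
`H¹(G_S, M) → H¹(K, M)` iff `c` is unramified at every finite place `v ∉ S`
(`galoisCohomology.IsUnramifiedAt`: the restriction of `c` to the inertia field `K̄^{I_𝔓}`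
vanishes for every `𝔓 ∣ v`).  (`⇒`: the absolute Galois group of the inertia field restricts into
`g I_𝔓 g⁻¹ ≤ N_S`, on which an inflated cocycle vanishes.  `⇐`: the cocycle is a coboundary
`σ ↦ σ m - m` on `g I_𝔓 g⁻¹ ≤ N_S`, where it therefore vanishes; so it vanishes on every `I_𝔓` and
hence on `N_S`, and inflation–restriction applies.)  This is the identification
`H¹(G_S, M) = ker (H¹(K, M) → ∏_{v ∉ S} H¹(I_v, M))` by which Selmer groups with local conditions
"unramified outside `S`" are computed in `G_S`-cohomology.
[cite: NeukirchSchmidtWingberg2008, (1.6.7) and VIII §3] [cite: MilneADT2006, Ch. I §4 (p. 55) and Lemma 4.8] -/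
theorem mem_range_restrictedInf_iff_forall_isUnramifiedAt (ρ : DiscreteGaloisModule K M)
    {S : Set (HeightOneSpectrum (𝓞 K))} (hur : GaloisRep.IsUnramifiedOutside S ρ)
    (c : galoisCohomology ρ 1) :
    c ∈ Set.range (ρ.restrictedInf S 1) ↔
      ∀ v ∉ S, galoisCohomology.IsUnramifiedAt v c := by
  have hρ : ramificationSubgroup K S ≤ ContinuousRep.ker ρ :=
    (ρ.isUnramifiedOutside_iff_ramificationSubgroup_le_ker S).1 hur
  obtain ⟨f, rfl⟩ := oneCocycleClass_surjective ρ.toTopRep c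
  -- restriction to the inertia field `T_𝔓` on cocycles
  have hres : ∀ (𝔓 : Ideal (absIntegers (𝓞 K) K)) (f₀ : contOneCocycles ρ.toTopRep),
      galoisCohomology.res ρ (absInertiaField K 𝔓) 1 (oneCocycleClass ρ.toTopRep f₀) =
        oneCocycleClass (DiscreteGaloisModule.toTopRep
          (GaloisRep.restrictField (absInertiaField K 𝔓) ρ))
          (contOneCocycles.pullback (absGaloisRestrict K (absInertiaField K 𝔓)) (X := ρ.toTopRep)
            (Y := DiscreteGaloisModule.toTopRep (GaloisRep.restrictField (absInertiaField K 𝔓) ρ))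
            (TopRep.ofHom ⟨ContinuousLinearMap.id ℤ M, fun _ => rfl⟩) f₀) :=
    fun 𝔓 f₀ => map_oneCocycleClass _ _ _ f₀
  constructor
  · -- `⇒`: an inflated cocycle vanishes on `N_S ⊇ res(Γ_T)`
    rintro ⟨x, hx⟩ v hv 𝔓 h𝔓
    -- the class is represented by a cocycle vanishing on `N_S`
    have hzero : ∃ f' : contOneCocycles ρ.toTopRep, oneCocycleClass ρ.toTopRep f' =
        oneCocycleClass ρ.toTopRep f ∧ ∀ σ ∈ ramificationSubgroup K S, f'.1 σ = 0 := by
      obtain ⟨ψ, rfl⟩ := oneCocycleClass_surjective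
        (ρ.quotientInvariants (ramificationSubgroup K S)).toTopRep x
      refine ⟨contOneCocycles.pullback (ContinuousMonoidHom.quotientMk (ramificationSubgroup K S))
        (X := (ρ.quotientInvariants (ramificationSubgroup K S)).toTopRep) (Y := ρ.toTopRep)
        (TopRep.ofHom ⟨Submodule.subtypeL _, fun _ => rfl⟩) ψ, ?_, fun σ hσ => ?_⟩
      · rw [← hx]
        exact (map_oneCocycleClass _ _ _ ψ).symm
      · rw [contOneCocycles.pullback_apply,
          show ContinuousMonoidHom.quotientMk (ramificationSubgroup K S) σ = 1 from
            (QuotientGroup.eq_one_iff _).mpr hσ, contOneCocycles.apply_one, map_zero]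
    obtain ⟨f', hf', hf'N⟩ := hzero
    have h0 : contOneCocycles.pullback (absGaloisRestrict K (absInertiaField K 𝔓)) (X := ρ.toTopRep)
        (Y := DiscreteGaloisModule.toTopRep (GaloisRep.restrictField (absInertiaField K 𝔓) ρ))
        (TopRep.ofHom ⟨ContinuousLinearMap.id ℤ M, fun _ => rfl⟩) f' = 0 :=
      Subtype.ext (ContinuousMap.ext fun h =>
        hf'N _ (absGaloisRestrict_absInertiaField_mem_ramificationSubgroup hv h𝔓 h))
    have h2 := hres 𝔓 f'
    rw [hf', h0] at h2
    exact h2.trans (oneCocycleClass_zero _)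
  · -- `⇐`: the cocycle vanishes on every `I_𝔓`, `𝔓 ∣ v ∉ S`, hence on `N_S`
    intro hc
    refine ρ.oneCocycleClass_mem_range_restrictedInf_of_forall_eq_zero S f
      (ρ.forall_ramificationSubgroup_eq_zero_of_forall_inertia hρ f fun v hv 𝔓 h𝔓 σ hσ => ?_)
    have h1 : oneCocycleClass _ _ = 0 := (hres 𝔓 f).symm.trans (hc v hv 𝔓 h𝔓)
    obtain ⟨m, hm⟩ := (oneCocycleClass_eq_zero_iff _ _).1 h1
    obtain ⟨g, hg⟩ := exists_range_absGaloisRestrict_absInertiaField (K := K) 𝔓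
    -- `g σ g⁻¹` is in the image of `Γ_T`, so `f (g σ g⁻¹) = (gσg⁻¹) • m - m = 0`
    have hmem : g * σ * g⁻¹ ∈ (absGaloisRestrict K (absInertiaField K 𝔓)).range :=
      (hg _).2 (by simpa [mul_assoc] using hσ)
    obtain ⟨h, hh⟩ := hmem
    have hN : g * σ * g⁻¹ ∈ ramificationSubgroup K S :=
      hh ▸ absGaloisRestrict_absInertiaField_mem_ramificationSubgroup hv h𝔓 h
    have hh' : absGaloisRestrict K (absInertiaField K 𝔓) h = g * σ * g⁻¹ := hh
    have hval : f.1 (g * σ * g⁻¹) = 0 := by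
      -- `hm h : f (res h) = ρ (res h) m - m` (through the identity maps)
      have h3 : f.1 (absGaloisRestrict K (absInertiaField K 𝔓) h) =
          ρ (absGaloisRestrict K (absInertiaField K 𝔓) h) m - m := hm h
      rw [hh'] at h3
      have hker : ρ (g * σ * g⁻¹) = LinearMap.id := (ContinuousRep.mem_ker ρ _).1 (hρ hN)
      rw [h3, hker, LinearMap.id_apply, sub_self]
    -- conjugate back: the zero set inside `N_S` is normal
    haveI := zeroSetIn_normal ρ S hρ f
    have hσ' : σ ∈ zeroSetIn ρ S hρ f := by
      have := (zeroSetIn_normal ρ S hρ f).conj_mem _ ((mem_zeroSetIn_iff ρ S hρ f _).2 ⟨hN, hval⟩) g⁻¹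
      simpa [mul_assoc] using this
    exact ((mem_zeroSetIn_iff ρ S hρ f σ).1 hσ').2

end Unramified

end DiscreteGaloisModule

end Literature.NumberTheory.GaloisRepresentations

end
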